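import Summits.CriticalPhenomena.PercolationContinuityZ3.Theorems.PercNearOneGluingNoHeavyQuantFarSunCertEightThree
import HarnessLib

/-!
# FAR beyond trees: **`HairyCycle.SunFAR 8 3`** — the exact reached-set-level two-copy certificate for the sun graph with `K = 8` hairs at layer `j = 3` (Kronecker-checked, 2 shard files) — shard file 2/2 (`l ∈ {7,8,9}`)

builds on p205010 (kernel theorem, internal audit signed; external expert review pending)

Support file (`--supports stmt-CriticalPhenomena-4575`), seat `prim-cert-1` (gen 26); memo `prim-cert-1/FROM-prim-cert-1-g26-CONFIG-CERTS.md`.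
Shard 2 of 2 of the Kronecker check of the `(8,3)` certificate (`PercNearOneGluingNoHeavyQuantFarSunCertEightThree`): prefix lengths `l ∈ {7, 8, 9}`
(1215 blocks; each shard file stays under the farm's elaboration budget).  COMPUTATIONAL (`native_decide`).  Assembles **`HairyCycle.sunFAR_eight_three : SunFAR 8 3`**.
[cite: KozmaNitzan2024, Lemma 2 (p. 6), Conjecture 3 (p. 15)] (context: the lower-tail family; FAR is this programme's statement).
-/

namespace Summit.CriticalPhenomena.PercolationContinuityZ3.Theorems.HairyCycle

namespace TK


/-- Core-inequality check of the `(8, 3)` certificate, shard `l ∈ {7, 8, 9}` (1215 blocks), base `2^151` (computational;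
one `native_decide`, so the record banks are built once). [this work] -/
theorem cK83_s2 : ([7, 8, 9].all fun l => kronL 8 151 (mkBanks 8 3 151 (mkNTabs 8 am83 bm83)) l) = true := by
  native_decide

end TK

/-- **FAR at layer `3` on the sun graph with `8` hairs, all weights: `SunFAR 8 3`** (exact reached-set-level two-copy certificate, kit j172305, Kronecker-checked in two shard files). [this work] -/
theorem sunFAR_eight_three : SunFAR 8 3 := by
  refine TK.sunFAR_of_kronL (s := 151) (by norm_num) TK.am83 TK.bm83 TK.cN83 fun l hl => ?_
  have h1 := List.all_eq_true.1 TK.cK83_s1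
  have h2 := List.all_eq_true.1 TK.cK83_s2
  interval_cases l
  · exact h1 0 (by simp)
  · exact h1 1 (by simp)
  · exact h1 2 (by simp)
  · exact h1 3 (by simp)
  · exact h1 4 (by simp)
  · exact h1 5 (by simp)
  · exact h1 6 (by simp)
  · exact h2 7 (by simp)
  · exact h2 8 (by simp)
  · exact h2 9 (by simp)

end Summit.CriticalPhenomena.PercolationContinuityZ3.Theorems.HairyCycle
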